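import Literature.NumberTheory.LFunctions.DedekindZetaZeroFreeRegionUniform
import HarnessLib

/-!
# The zero-free region of the Dedekind zeta function with an ABSOLUTE constant
# (Lagarias–Odlyzko Lemma 8.1 / Thorner–Zaman Theorem 3.1 for `χ = 1`, uniformly in the degree)

Topic `Literature/NumberTheory/LFunctions` (namespace `Literature.NumberTheory.LFunctions.NumberField`).
Everything in this file is PROVED (theorems only; no named facts).

`DedekindZetaZeroFreeRegionUniform.lean` proves: for every `n` there is `c = c(n) > 0` such that
for every number field `K` of degree `n`, every zero `ρ = β + iγ` of `ζ_K` with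
`β > 1 − c/(log|d_K| + log(|γ| + 4))` is real.  The ONLY place where the degree enters that proof is
the comparison `77760 M_K(t) ≤ 77760(5n + 2)(log|d_K| + log(|t| + 4))` of the Lagarias–Odlyzko
error term `M_K(t) = log|d_K| + 3n_K + (n_K + 1) log(|t| + 7)` (`discBound K t`) with
`log|d_K| + log(|t| + 4)`.  Measuring the region by `M_K` itself — as Lagarias–Odlyzko
[LO, Lemma 8.1] (`σ ≥ 1 − c/log(d_L(|t| + 2)^{n_L})`) and Thorner–Zaman [TZ, Theorem 3.1]
(`σ > 1 − c/log(Q(|t| + 3)^{n_K})`, `Q = |d_K| n_K^{n_K}`) do — the same proof gives an ABSOLUTE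
constant:

* `discBound_two_mul_le`, `discBound_zero_le_discBound`, `discBound_le_two_mul_of_near`,
  `three_mul_finrank_le_discBound` — `M_K` is a size functional (`M_K(2t) ≤ 2M_K(t)` etc.);
* `zeroFree_far_absolute`, `zeroFree_near_absolute` — the two cases of
  `DedekindZetaZeroFreeRegionUniform.lean` with right-hand sides `9 · 77760 · M_K(γ)`, `77760 M_K(0)`;
* `exists_zeroFree_dedekindZeta₁_absolute` — **there is an absolute `c > 0` such that for every
  number field `K` and every zero `ρ` of `ζ₁_K = (s−1)ζ_K` with `Re ρ > 1 − c/M_K(Im ρ)`,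
  `Im ρ = 0`**; `exists_zeroFree_dedekindZetaCont_absolute` — the same for `ζ_K` (`ρ ≠ 1`);
* `discBound_le_seven_mul` — `M_K(t) ≤ 7(log|d_K| + n_K log n_K + n_K log(|t| + 3)) = 7 log(Q(|t|+3)^{n_K})`
  for `n_K ≥ 2`: the region contains Thorner–Zaman's `σ > 1 − (c/7)/log(Q(|t| + 3)^{n_K})`.

## References

* J. C. Lagarias, A. M. Odlyzko, *Effective versions of the Chebotarev density theorem* (1977),
  Lemmas 5.6, 8.1, 8.2. [LagariasOdlyzko1977]
* H. M. Stark, *Some effective cases of the Brauer–Siegel theorem*, Invent. Math. 23 (1974),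
  Lemma 3. [folklore]
* H. L. Montgomery, R. C. Vaughan, *Multiplicative Number Theory I*, CUP 2007, Theorems 6.6, 11.3.
  [MontgomeryVaughan2007]
* J. Thorner, A. Zaman, *A unified and improved Chebotarev density theorem*, ANT 13 (2019),
  Theorem 3.1, (3.2). [ThornerZaman2019]
-/

noncomputable section

open scoped NumberField nonZeroDivisors ComplexConjugate
open Complex Filter Topology Set Metric MeromorphicOn NumberField

namespace Literature.NumberTheory.LFunctions.NumberField

variable {K : Type*} [Field K] [NumberField K]

/-! ### `M_K(t)` is a size functional -/

/-- `log(|t'| + 7) ≤ 2 log(|t| + 7)` if `|t'| ≤ 2|t| + 7` (`|t'| + 7 ≤ 2(|t| + 7) ≤ (|t| + 7)²`).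
[folklore] -/
theorem log_abs_add_seven_le_two_mul {t t' : ℝ} (h : |t'| ≤ 2 * |t| + 7) :
    Real.log (|t'| + 7) ≤ 2 * Real.log (|t| + 7) := by
  rw [← Real.log_rpow (by positivity), Real.rpow_two]
  exact Real.log_le_log (by positivity) (by nlinarith [abs_nonneg t, abs_nonneg t'])

/-- Doubling the ordinate: `M_K(2t) ≤ 2 M_K(t)`. [folklore] -/
theorem discBound_two_mul_le (t : ℝ) : discBound K (2 * t) ≤ 2 * discBound K t := by
  unfold discBound
  have h1 : 0 ≤ Real.log ((discr K).natAbs : ℝ) := Real.log_natCast_nonneg _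
  have h2 : (0 : ℝ) ≤ Module.finrank ℚ K := Nat.cast_nonneg _
  have h3 : Real.log (|2 * t| + 7) ≤ 2 * Real.log (|t| + 7) :=
    log_abs_add_seven_le_two_mul (by rw [abs_mul, abs_two]; linarith [abs_nonneg t])
  have h4 : 0 ≤ Real.log (|t| + 7) := (zero_le_one.trans (one_le_log_abs_add_seven t))
  nlinarith [mul_le_mul_of_nonneg_left h3 (by linarith : (0 : ℝ) ≤ Module.finrank ℚ K + 1)]

/-- Height `0` is the lowest: `M_K(0) ≤ M_K(t)`. [folklore] -/
theorem discBound_zero_le_discBound (t : ℝ) : discBound K 0 ≤ discBound K t := by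
  unfold discBound
  have h2 : (0 : ℝ) ≤ Module.finrank ℚ K + 1 := by positivity
  have h3 : Real.log (|(0 : ℝ)| + 7) ≤ Real.log (|t| + 7) := by
    rw [abs_zero]
    exact Real.log_le_log (by norm_num) (by linarith [abs_nonneg t])
  nlinarith [mul_le_mul_of_nonneg_left h3 h2]

/-- Nearby ordinates: `M_K(t') ≤ 2 M_K(t)` if `|t' − t| ≤ 1`. [folklore] -/
theorem discBound_le_two_mul_of_near (t t' : ℝ) (h : |t' - t| ≤ 1) :
    discBound K t' ≤ 2 * discBound K t := by
  unfold discBound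
  have h1 : 0 ≤ Real.log ((discr K).natAbs : ℝ) := Real.log_natCast_nonneg _
  have h2 : (0 : ℝ) ≤ Module.finrank ℚ K := Nat.cast_nonneg _
  have h3 : Real.log (|t'| + 7) ≤ 2 * Real.log (|t| + 7) := by
    refine log_abs_add_seven_le_two_mul ?_
    have := abs_sub_abs_le_abs_sub t' t
    linarith [abs_nonneg t]
  have h4 : 0 ≤ Real.log (|t| + 7) := (zero_le_one.trans (one_le_log_abs_add_seven t))
  nlinarith [mul_le_mul_of_nonneg_left h3 (by linarith : (0 : ℝ) ≤ Module.finrank ℚ K + 1)]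

/-- `3 n_K ≤ M_K(t)`. [folklore] -/
theorem three_mul_finrank_le_discBound (t : ℝ) : 3 * (Module.finrank ℚ K : ℝ) ≤ discBound K t := by
  unfold discBound
  have h1 : 0 ≤ Real.log ((discr K).natAbs : ℝ) := Real.log_natCast_nonneg _
  have h4 : 0 ≤ Real.log (|t| + 7) := (zero_le_one.trans (one_le_log_abs_add_seven t))
  have h2 : (0 : ℝ) ≤ Module.finrank ℚ K + 1 := by positivity
  nlinarith [mul_nonneg h2 h4]

/-! ### Comparison with Thorner–Zaman's `log(Q (|t| + 3)^{n_K})` -/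

/-- **`M_K(t) ≤ 7 (log|d_K| + n_K log n_K + n_K log(|t| + 3))` for `n_K ≥ 2`**: with
`Q = |d_K| n_K^{n_K}` this is `M_K(t) ≤ 7 log(Q (|t| + 3)^{n_K})`, so that the region of
`exists_zeroFree_classGroupLFunction₀_absolute` contains Thorner–Zaman's
`σ > 1 − (c/7)/log(Q (|t| + 3)^{n_K})` (`3n ≤ 5 n log n`, `(n+1) log(|t|+7) ≤ 2n log(|t|+3) + 2n`,
`log 7 ≤ log 3 + 1`, `n ≤ 2 n log n` for `n ≥ 2`). [cite: ThornerZaman2019, (3.2)] -/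
theorem discBound_le_seven_mul (hK : 1 < Module.finrank ℚ K) (t : ℝ) :
    discBound K t ≤ 7 * (Real.log ((discr K).natAbs : ℝ) +
      Module.finrank ℚ K * Real.log (Module.finrank ℚ K) + Module.finrank ℚ K * Real.log (|t| + 3)) := by
  unfold discBound
  set n : ℕ := Module.finrank ℚ K with hn
  have hn2 : (2 : ℝ) ≤ n := by exact_mod_cast hK
  have h1 : 0 ≤ Real.log ((discr K).natAbs : ℝ) := Real.log_natCast_nonneg _
  have hlog2 : (6931471803 : ℝ) / 10000000000 < Real.log 2 := by
    have := Real.log_two_gt_d9; linarith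
  have hlogn : Real.log 2 ≤ Real.log n := Real.log_le_log two_pos hn2
  have hl3 : 1 ≤ Real.log (|t| + 3) := by
    rw [← Real.log_exp 1]
    refine Real.log_le_log (Real.exp_pos 1) ?_
    have := Real.exp_one_lt_d9
    linarith [abs_nonneg t]
  -- `log(|t| + 7) ≤ log(|t| + 3) + 1` (`|t| + 7 ≤ e (|t| + 3)`)
  have hl7 : Real.log (|t| + 7) ≤ Real.log (|t| + 3) + 1 := by
    have he : Real.log (|t| + 7) ≤ Real.log (Real.exp 1 * (|t| + 3)) := by
      refine Real.log_le_log (by positivity) ?_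
      have := Real.exp_one_gt_d9
      nlinarith [abs_nonneg t]
    rw [Real.log_mul (Real.exp_pos 1).ne' (by positivity), Real.log_exp] at he
    linarith
  have hnlogn : (0.69 : ℝ) * n ≤ n * Real.log n := by nlinarith
  have hA : ((n : ℝ) + 1) * Real.log (|t| + 7) ≤ 2 * n * Real.log (|t| + 3) + 2 * n := by
    have : ((n : ℝ) + 1) ≤ 2 * n := by linarith
    have h0 : 0 ≤ Real.log (|t| + 7) := zero_le_one.trans (one_le_log_abs_add_seven t)
    calc ((n : ℝ) + 1) * Real.log (|t| + 7) ≤ 2 * n * Real.log (|t| + 7) :=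
          mul_le_mul_of_nonneg_right this h0
      _ ≤ 2 * n * (Real.log (|t| + 3) + 1) := mul_le_mul_of_nonneg_left hl7 (by positivity)
      _ = 2 * n * Real.log (|t| + 3) + 2 * n := by ring
  nlinarith

/-! ### The two cases, measured by `M_K` -/

set_option maxHeartbeats 800000 in
/-- **FAR zeros, degree-uniformly** (`|γ| ≥ 30(1 − β)`): if `ρ = β + iγ` is a zero of `ζ₁_K` with
`0 < 1 − β ≤ 1/64` and `|γ| ≥ 30(1 − β)`, then `(1/25)/(1 − β) ≤ 9 · 77760 · M_K(γ)`:
`3–4–1` at `σ = 1 + 6(1 − β)` and heights `0, γ, 2γ` (`M_K(0) ≤ M_K(γ)`, `M_K(2γ) ≤ 2M_K(γ)`).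
The proof of `zeroFree_far` verbatim, without the step `77760 M_K(t) ≤ K'(n)(log|d_K| + log(|t|+4))`.
[cite: MontgomeryVaughan2007, Theorem 6.6 (proof); LagariasOdlyzko1977, Lemma 8.1] -/
theorem zeroFree_far_absolute {β γ : ℝ} (hzero : dedekindZeta₁ K (β + γ * I) = 0) (hu0 : 0 < 1 - β)
    (husmall : 1 - β ≤ 1 / 64) (hfar : 30 * (1 - β) ≤ |γ|) :
    (1 / 25) * (1 / (1 - β)) ≤ 9 * 77760 * discBound K γ := by
  set u : ℝ := 1 - β with hu
  have hΛ : ∀ m, 0 ≤ vonMangoldtNorm K m := vonMangoldtNorm_nonneg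
  have hsum : ∀ s : ℂ, 1 < s.re → LSeriesSummable (fun m ↦ (vonMangoldtNorm K m : ℂ)) s :=
    fun s hs ↦ LSeriesSummable_vonMangoldtNorm hs
  set d : ℝ := 6 * u with hddef
  have hdpos : 0 < d := by positivity
  have hd1 : d ≤ 1 := by rw [hddef]; linarith
  have hσ₀1 : 1 < 1 + d := by linarith
  have hσ₀2 : 1 + d ≤ 2 := by linarith
  have h341 := ClassicalZFRData.three_four_one hΛ hsum hσ₀1 γ
  -- (A0)
  have hA0 := re_LSeries_vonMangoldtNorm_le (K := K) (s := ((1 + d : ℝ) : ℂ)) (by simpa using hσ₀1)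
    (by simpa using hσ₀2)
  have e0 : (1 / (((1 + d : ℝ) : ℂ) - 1)).re = 1 / d := by
    rw [show ((1 + d : ℝ) : ℂ) - 1 = ((d : ℝ) : ℂ) by push_cast; ring, ← Complex.ofReal_one,
      ← Complex.ofReal_div, Complex.ofReal_re]
  rw [e0, Complex.ofReal_im] at hA0
  have hM0 : 77760 * discBound K 0 ≤ 77760 * discBound K γ :=
    mul_le_mul_of_nonneg_left (discBound_zero_le_discBound γ) (by norm_num)
  -- (A1) at `1 + d + iγ`, keeping the zero `ρ`
  have hρdisc : (β + γ * I : ℂ) ∈ closedBall (2 + (((1 + d : ℝ) : ℂ) + γ * I).im * I) (31 / 16) := by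
    have him : (((1 + d : ℝ) : ℂ) + γ * I).im = γ := by simp
    rw [him, mem_closedBall, dist_eq_norm,
      show (β : ℂ) + γ * I - (2 + γ * I) = ((β - 2 : ℝ) : ℂ) by push_cast; ring,
      Complex.norm_real, Real.norm_eq_abs, abs_le]
    constructor <;> linarith
  have hA1 := re_LSeries_vonMangoldtNorm_le_of_zeros (K := K) (s := ((1 + d : ℝ) : ℂ) + γ * I)
    (by simp; linarith) (by simp; linarith) {(β + γ * I : ℂ)} (fun _ ↦ 1)
    (fun v hv ↦ by
      rw [Finset.mem_singleton] at hv
      rw [hv]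
      exact ⟨hzero, hρdisc, one_le_analyticOrderAt_dedekindZeta₁ hzero⟩)
  rw [Finset.sum_singleton] at hA1
  have him1 : (((1 + d : ℝ) : ℂ) + γ * I).im = γ := by simp
  have e1 : (1 / ((((1 + d : ℝ) : ℂ) + γ * I) - 1)).re = d / (d ^ 2 + γ ^ 2) := by
    rw [one_div, show (((1 + d : ℝ) : ℂ) + γ * I) - 1 = ((d : ℝ) : ℂ) + ((γ : ℝ) : ℂ) * I by push_cast; ring,
      DirichletZFR.re_inv_ofReal_add_mul_I]
  have e1' : (((((1 + d : ℝ) : ℂ) + γ * I) - (β + γ * I))⁻¹).re = 1 / (d + u) := by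
    rw [show (((1 + d : ℝ) : ℂ) + γ * I) - (β + γ * I) = ((d + u : ℝ) : ℂ) by rw [hu]; push_cast; ring,
      ← Complex.ofReal_inv, Complex.ofReal_re, one_div]
  rw [him1, e1, e1'] at hA1
  simp only [Nat.cast_one, one_mul] at hA1
  -- (A2) at `1 + d + 2iγ`
  have hA2 := re_LSeries_vonMangoldtNorm_le (K := K) (s := ((1 + d : ℝ) : ℂ) + (2 * γ) * I)
    (by simp; linarith) (by simp; linarith)
  have him2 : (((1 + d : ℝ) : ℂ) + (2 * γ) * I).im = 2 * γ := by simp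
  have e2 : (1 / ((((1 + d : ℝ) : ℂ) + (2 * γ) * I) - 1)).re = d / (d ^ 2 + (2 * γ) ^ 2) := by
    rw [one_div, show (((1 + d : ℝ) : ℂ) + (2 * γ) * I) - 1 = ((d : ℝ) : ℂ) + ((2 * γ : ℝ) : ℂ) * I by
        push_cast; ring, DirichletZFR.re_inv_ofReal_add_mul_I]
  rw [him2, e2] at hA2
  have hM2 : 77760 * discBound K (2 * γ) ≤ 2 * 77760 * discBound K γ := by
    have h2 := discBound_two_mul_le (K := K) γ
    linarith
  -- pole terms
  have hγ2 : 900 * u ^ 2 ≤ γ ^ 2 := by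
    have h30 : 0 ≤ 30 * u := by positivity
    have := mul_le_mul hfar hfar h30 (abs_nonneg γ)
    rw [← pow_two, ← pow_two, sq_abs] at this
    nlinarith
  have hp1 : d / (d ^ 2 + γ ^ 2) ≤ 1 / (156 * u) := by
    rw [div_le_div_iff₀ (by positivity) (by positivity), hddef]; nlinarith
  have hp2 : d / (d ^ 2 + (2 * γ) ^ 2) ≤ 1 / (606 * u) := by
    rw [div_le_div_iff₀ (by positivity) (by positivity), hddef]; nlinarith
  have e3 : 1 / d = 1 / (6 * u) := by rw [hddef]
  have e4 : 1 / (d + u) = 1 / (7 * u) := by rw [hddef]; ring_nf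
  rw [e3] at hA0
  rw [e4] at hA1
  have hpt : (((1 + d : ℝ) : ℂ) + (2 * γ) * I) = ((1 + d : ℝ) : ℂ) + 2 * γ * I := by push_cast; ring
  rw [hpt] at hA2
  set ℒ : ℝ := discBound K γ with hℒ
  have hkey : 4 * (1 / (7 * u)) - 3 * (1 / (6 * u)) - 4 * (1 / (156 * u)) - 1 / (606 * u) ≤
      9 * 77760 * ℒ := by
    linarith [hA0, hA1, hA2, h341, hp1, hp2, hM0, hM2]
  have hv7 : 1 / (7 * u) = 1 / 7 * (1 / u) := by rw [one_div_mul_one_div]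
  have hv6 : 1 / (6 * u) = 1 / 6 * (1 / u) := by rw [one_div_mul_one_div]
  have hv156 : 1 / (156 * u) = 1 / 156 * (1 / u) := by rw [one_div_mul_one_div]
  have hv606 : 1 / (606 * u) = 1 / 606 * (1 / u) := by rw [one_div_mul_one_div]
  rw [hv7, hv6, hv156, hv606] at hkey
  have hv0 : 0 < 1 / u := by positivity
  nlinarith [hkey, hv0]

set_option maxHeartbeats 800000 in
/-- **NEAR zeros, degree-uniformly** (`0 < |γ| < 30(1 − β)`, Stark's device): if `ρ = β + iγ`,
`γ ≠ 0`, is a zero of `ζ₁_K` with `0 < 1 − β ≤ 1/64` and `|γ| < 30(1 − β)`, then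
`(1/103)/(1 − β) ≤ 77760 M_K(0)`: `ρ̄` is a second zero, and at the real point `σ = 1 + 62(1 − β)`,
`0 ≤ L(Λ_K, σ) ≤ 1/(σ−1) − 2 Re 1/(σ − ρ) + 77760 M_K(0)`.  The proof of `zeroFree_near` verbatim.
[cite: LagariasOdlyzko1977, Lemma 8.1] -/
theorem zeroFree_near_absolute {β γ : ℝ} (hzero : dedekindZeta₁ K (β + γ * I) = 0) (hγ0 : γ ≠ 0)
    (hu0 : 0 < 1 - β) (husmall : 1 - β ≤ 1 / 64) (hnear : |γ| < 30 * (1 - β)) :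
    (1 / 103) * (1 / (1 - β)) ≤ 77760 * discBound K 0 := by
  set u : ℝ := 1 - β with hu
  set σ : ℝ := 1 + 62 * u with hσdef
  have hσ1 : 1 < σ := by rw [hσdef]; linarith
  have hσ2 : σ ≤ 2 := by rw [hσdef]; linarith
  have hzero' : dedekindZeta₁ K (β - γ * I) = 0 := by
    have h := dedekindZeta₁_conj_eq_zero hzero
    rwa [map_add, map_mul, Complex.conj_ofReal, Complex.conj_ofReal, Complex.conj_I, mul_neg,
      ← sub_eq_add_neg] at h
  have hne : (β + γ * I : ℂ) ≠ β - γ * I := by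
    intro h
    have := congrArg Complex.im h
    simp at this
    exact hγ0 (by linarith)
  have hγ2 : γ ^ 2 ≤ 900 * u ^ 2 := by
    have h30 : 0 ≤ 30 * u := by positivity
    have := mul_le_mul hnear.le hnear.le (abs_nonneg γ) h30
    rw [← pow_two, ← pow_two, sq_abs] at this
    nlinarith
  have hb : (β - 2) ^ 2 ≤ (1 + 1 / 64) ^ 2 := by
    have h1 : 0 ≤ 2 - β := by linarith
    have h2 : 2 - β ≤ 1 + 1 / 64 := by linarith
    have := mul_le_mul h2 h2 h1 (by norm_num)
    nlinarith
  have hγ2' : γ ^ 2 ≤ 900 * (1 / 64) ^ 2 := by nlinarith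
  have hdisc : ∀ e : ℝ, e ^ 2 = γ ^ 2 → (β + e * I : ℂ) ∈ closedBall (2 + ((σ : ℂ)).im * I) (31 / 16) := by
    intro e he
    rw [Complex.ofReal_im, Complex.ofReal_zero, zero_mul, add_zero, mem_closedBall, dist_eq_norm]
    have hsq : ‖(β + e * I : ℂ) - 2‖ ^ 2 = (β - 2) ^ 2 + e ^ 2 := by
      rw [show (β : ℂ) + e * I - 2 = ((β - 2 : ℝ) : ℂ) + ((e : ℝ) : ℂ) * I by push_cast; ring,
        ← Complex.normSq_eq_norm_sq, Complex.normSq_add_mul_I]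
    have hsq' : ‖(β + e * I : ℂ) - 2‖ ^ 2 ≤ (31 / 16) ^ 2 := by rw [hsq, he]; nlinarith
    exact (sq_le_sq₀ (norm_nonneg _) (by norm_num)).mp hsq'
  have hdisc₁ := hdisc γ rfl
  have hdisc₂ := hdisc (-γ) (by ring)
  have hpt₂ : (β + (-γ : ℝ) * I : ℂ) = β - γ * I := by push_cast; ring
  rw [hpt₂] at hdisc₂
  have hA := re_LSeries_vonMangoldtNorm_le_of_zeros (K := K) (s := (σ : ℂ)) (by simpa using hσ1)
    (by simpa using hσ2) {(β + γ * I : ℂ), (β - γ * I : ℂ)} (fun _ ↦ 1)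
    (fun v hv ↦ by
      have hv' : v = β + γ * I ∨ v = β - γ * I := by
        simpa [Finset.mem_insert, Finset.mem_singleton] using hv
      rcases hv' with h | h
      · rw [h]; exact ⟨hzero, hdisc₁, one_le_analyticOrderAt_dedekindZeta₁ hzero⟩
      · rw [h]; exact ⟨hzero', hdisc₂, one_le_analyticOrderAt_dedekindZeta₁ hzero'⟩)
  rw [Finset.sum_pair hne, Complex.ofReal_im] at hA
  simp only [Nat.cast_one, one_mul] at hA
  have e0 : (1 / ((σ : ℂ) - 1)).re = 1 / (62 * u) := by
    rw [show (σ : ℂ) - 1 = ((62 * u : ℝ) : ℂ) by rw [hσdef]; push_cast; ring, ← Complex.ofReal_one,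
      ← Complex.ofReal_div, Complex.ofReal_re]
  have e₁ : (((σ : ℂ) - (β + γ * I))⁻¹).re = (63 * u) / ((63 * u) ^ 2 + γ ^ 2) := by
    rw [show (σ : ℂ) - (β + γ * I) = ((63 * u : ℝ) : ℂ) + ((-γ : ℝ) : ℂ) * I by rw [hσdef, hu]; push_cast; ring,
      DirichletZFR.re_inv_ofReal_add_mul_I]; ring
  have e₂ : (((σ : ℂ) - (β - γ * I))⁻¹).re = (63 * u) / ((63 * u) ^ 2 + γ ^ 2) := by
    rw [show (σ : ℂ) - (β - γ * I) = ((63 * u : ℝ) : ℂ) + ((γ : ℝ) : ℂ) * I by rw [hσdef, hu]; push_cast; ring,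
      DirichletZFR.re_inv_ofReal_add_mul_I]
  rw [e0, e₁, e₂] at hA
  have hpos : 0 ≤ (LSeries (fun m ↦ (vonMangoldtNorm K m : ℂ)) σ).re := by
    have h := TwistedZFR.norm_LSeries_le_of_norm_le (f := fun m ↦ (vonMangoldtNorm K m : ℂ))
      (Λ₀ := vonMangoldtNorm K) (fun m ↦ by
        rw [Complex.norm_real, Real.norm_of_nonneg (vonMangoldtNorm_nonneg m)])
      (fun s hs ↦ LSeriesSummable_vonMangoldtNorm hs) (s := (σ : ℂ)) hσ1 (by simp)
    exact (norm_nonneg _).trans h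
  have hpair : 126 / (4869 * u) ≤ 2 * ((63 * u) / ((63 * u) ^ 2 + γ ^ 2)) := by
    rw [mul_div_assoc', div_le_div_iff₀ (by positivity) (by positivity)]; nlinarith
  have hkey : 126 / (4869 * u) - 1 / (62 * u) ≤ 77760 * discBound K 0 := by
    linarith [hA, hpos, hpair]
  have hv1 : 126 / (4869 * u) = 126 / 4869 * (1 / u) := by rw [mul_one_div, div_div]
  have hv2 : 1 / (62 * u) = 1 / 62 * (1 / u) := by rw [one_div_mul_one_div]
  rw [hv1, hv2] at hkey
  have hv0 : 0 < 1 / u := by positivity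
  nlinarith [hkey, hv0]

/-- **The zero-free region for `ζ_K` with an ABSOLUTE constant** (Lagarias–Odlyzko Lemma 8.1 with
Stark's Lemma; [ThornerZaman2019, Theorem 3.1], `χ = 1`): there is an absolute `c > 0` such that for
EVERY number field `K` (any degree) and every zero `ρ` of `ζ₁_K(s) = (s − 1)ζ_K(s)` with
`Re ρ > 1 − c/M_K(Im ρ)`, `M_K(t) = log|d_K| + 3n_K + (n_K + 1) log(|t| + 7)`, one has `Im ρ = 0`.
[cite: LagariasOdlyzko1977, Lemma 8.1] -/
theorem exists_zeroFree_dedekindZeta₁_absolute :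
    ∃ c : ℝ, 0 < c ∧ ∀ (K : Type) [Field K] [NumberField K],
      ∀ ρ : ℂ, dedekindZeta₁ K ρ = 0 → 1 - c / discBound K ρ.im < ρ.re → ρ.im = 0 := by
  set Kc : ℝ := 77760 with hKc
  have hKcpos : 0 < Kc := by rw [hKc]; norm_num
  set c : ℝ := min (1 / 64) (1 / (225 * Kc + 1)) with hcdef
  have hc : 0 < c := lt_min (by norm_num) (by positivity)
  have hc64 : c ≤ 1 / 64 := min_le_left _ _
  have hcK : c ≤ 1 / (225 * Kc + 1) := min_le_right _ _
  refine ⟨c, hc, fun K _ _ ρ hzero hregion ↦ ?_⟩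
  by_contra hγ0
  have hρ : ρ = (ρ.re : ℂ) + (ρ.im : ℂ) * I := (Complex.re_add_im ρ).symm.trans (by simp [mul_comm])
  have hzero' : dedekindZeta₁ K ((ρ.re : ℂ) + (ρ.im : ℂ) * I) = 0 := by rw [← hρ]; exact hzero
  set ℒ : ℝ := discBound K ρ.im with hℒ
  have hℒ1 : 1 ≤ ℒ := one_le_discBound K ρ.im
  have hℒ0 : 0 < ℒ := by linarith
  have hℒ₀ℒ : discBound K 0 ≤ ℒ := discBound_zero_le_discBound ρ.im
  have hcℒ : c / ℒ ≤ c := div_le_self hc.le hℒ1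
  have hβ1 : ρ.re < 1 := by
    by_contra h
    exact dedekindZeta₁_ne_zero_of_one_le_re (K := K) (s := ρ) (not_lt.mp h) hzero
  have hu0 : 0 < 1 - ρ.re := by linarith
  have hularge : 1 - ρ.re < c / ℒ := by linarith
  have husmall : 1 - ρ.re ≤ 1 / 64 := by linarith
  have hc' : c * (225 * Kc + 1) ≤ 1 := by
    rw [le_div_iff₀ (by positivity)] at hcK; linarith
  rcases le_or_gt (30 * (1 - ρ.re)) |ρ.im| with hfar | hnear
  · have h : (1 / 25) * (1 / (1 - ρ.re)) ≤ 9 * Kc * ℒ := zeroFree_far_absolute hzero' hu0 husmall hfar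
    have h1 : 1 / 25 ≤ 9 * Kc * ℒ * (1 - ρ.re) := by
      have := mul_le_mul_of_nonneg_right h hu0.le
      rwa [mul_assoc (1 / 25 : ℝ), one_div_mul_cancel hu0.ne', mul_one] at this
    have h2 : 1 / (225 * Kc) ≤ ℒ * (1 - ρ.re) := by
      rw [div_le_iff₀ (by positivity)]; nlinarith [h1]
    have h3 : c ≤ 1 / (225 * Kc) :=
      hcK.trans (one_div_le_one_div_of_le (by positivity) (by linarith))
    have hfinal : c / ℒ ≤ 1 - ρ.re := by
      rw [div_le_iff₀ hℒ0]; nlinarith [h2, h3]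
    linarith
  · have h : (1 / 103) * (1 / (1 - ρ.re)) ≤ Kc * discBound K 0 :=
      zeroFree_near_absolute hzero' hγ0 hu0 husmall hnear
    have h1 : 1 / 103 ≤ Kc * ℒ * (1 - ρ.re) := by
      have := mul_le_mul_of_nonneg_right h hu0.le
      rw [mul_assoc (1 / 103 : ℝ), one_div_mul_cancel hu0.ne', mul_one] at this
      have hKℒ : Kc * discBound K 0 ≤ Kc * ℒ := mul_le_mul_of_nonneg_left hℒ₀ℒ hKcpos.le
      have := mul_le_mul_of_nonneg_right hKℒ hu0.le
      linarith
    have h2 : 1 / (103 * Kc) ≤ ℒ * (1 - ρ.re) := by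
      rw [div_le_iff₀ (by positivity)]; nlinarith [h1]
    have h3 : c ≤ 1 / (103 * Kc) :=
      hcK.trans (one_div_le_one_div_of_le (by positivity) (by linarith))
    have hfinal : c / ℒ ≤ 1 - ρ.re := by
      rw [div_le_iff₀ hℒ0]; nlinarith [h2, h3]
    linarith

/-- The same for the continued `ζ_K` (`dedekindZetaCont`), `ρ ≠ 1`. [cite: LagariasOdlyzko1977, Lemma 8.1] -/
theorem exists_zeroFree_dedekindZetaCont_absolute :
    ∃ c : ℝ, 0 < c ∧ ∀ (K : Type) [Field K] [NumberField K],
      ∀ ρ : ℂ, ρ ≠ 1 → dedekindZetaCont K ρ = 0 → 1 - c / discBound K ρ.im < ρ.re → ρ.im = 0 := by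
  obtain ⟨c, hc, h⟩ := exists_zeroFree_dedekindZeta₁_absolute
  refine ⟨c, hc, fun K _ _ ρ hρ1 hρ hregion ↦ h K ρ ?_ hregion⟩
  rw [dedekindZeta₁_apply_of_ne_one hρ1, hρ, mul_zero]

end Literature.NumberTheory.LFunctions.NumberField

end
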